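import Summits.BirchSwinnertonDyer.BirchSwinnertonDyer.Theorems.SchneiderFreeAdditiveX3PoitouTateMuLevelChangeCharacter
import Summits.BirchSwinnertonDyer.BirchSwinnertonDyer.Theorems.SchneiderFreeAdditiveX3PoitouTateMuLevelKummerUnramified
import Summits.BirchSwinnertonDyer.BirchSwinnertonDyer.Theorems.SchneiderFreeAdditiveX3PoitouTateMiddleExactCoprime
import Summits.BirchSwinnertonDyer.BirchSwinnertonDyer.Theorems.SchneiderFreeAdditiveX3PoitouTateMiddleExactTrivialCoefficients
import HarnessLib

/-!
# Poitou–Tate toolkit (μₙ-case at EVERY level, 3/·): Milne *ADT* I Thm. 4.10(b) `Ker γ¹ ⊆ Im β¹` for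
# `M = μₙ`, THE invariant maps, EVERY level `n ≥ 1` — whenever every REAL place of `K` sees an odd `n`
# (`∀ w, w.IsReal → Odd n`: any `K` for odd `n`, totally complex `K` for all `n`) — UNCONDITIONAL

Cell `bsd-schneider-ideate`, seat `bsd-schneider-door-c6` (prover, generation 7).  PARTITION: board row
B6 ∩ X3 ∩ sst-twist, `r = 1` — CONTROL corner (crux `AnticycControlAdditiveK`, stmt-BirchSwinnertonDyer-19295;
stubs `stub_baseCountTors` / `stub_ptSurj` hinge on `hE` for ALL finite `M`).  THEOREMS ONLY.  HONEST
FRAMING: the `μₙ`-instance of the hypothesis `hE` of `exists_localInvariants_duality_of_middleExact_canonical`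
at an ARBITRARY level `n` (door-c6 g6: prime level only); the general `hE` — all finite `M` — is NOT
claimed; no case of BSD.

`middleExact_mu_level`: door-c6 g6's proof (`middleExact_mu_of_isComplex_or_odd`, p500326) verbatim, except
at the one point where primality entered: a faithful class-field character `χ` of exponent `n` has a cyclic
character `ψ : Γ_K ↠ ℤ/d` of some level `d ∣ n`, `n = d·m`, in general NOT `d ∈ {1, n}`.  The test class is
then `y = Ψ_*[ψ·id_{μ_d}] ∈ H¹(K, μₙ^D)` for the level change `Ψ : Hom(μ_d, μ_d) → Hom(μₙ, μₙ)` (file 1/·,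
`exists_tateDual_muLevel_intertwining`), unramified off `S` with `[ψ·id]`, and its local pairings with the
Kummer classes `t_v = loc_v κₙ(b)` are `m · (ψ, b)_v` read in `ℤ/n`
(`localInvariantMap_localization_cupProduct_δ₀_map_scalarCocycle` + Serre XIV §1 Prop. 3
`localInvariantMap_localization_cupProduct_δ₀_eq_neg_apply` at level `d`); as `r ↦ r·m : ℤ/d ↪ ℤ/n` is
injective, orthogonality gives `∑_v ψ(res_v w_v) = 0` in `ℤ/d`, i.e. `χ(ψ_{L|K} ξ) = 1`, as before.  The
Kummer-unit inputs at level `n` are file 2/· (`…MuLevelKummerUnramified`).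

Consequences at every level `n` (§2–§3, by the transport / duality-symmetry tools of
`…PoitouTateMiddleExactTrivialCoefficients` and `…PoitouTateMiddleExactDualSymmetry`):
`middleExact_canonical_muDual_level` — `hE` for `M = μₙ^D`; `middleExact_canonical_trivial_level` — `hE` for
the CONSTANT module `ℤ/n` (any trivial-action structure on `ZMod n`): Grunwald–Wang with ramification control in
Poitou–Tate form.  Together with door-c6 g6 (prime level) these are ALL the rank-one constant / cyclotomic
coefficient modules; the general `hE` (all finite `M`, e.g. `E[p^k]`) remains class-formation cohomology.

References: [MilneADT2006] I Thm. 4.10(b), I Ex. 1.6 (c); [CasselsFrohlichANT1967] VII §5.1, §11;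
[SerreLocalFields1979] XIV §1 Prop. 3, XIII §3.
-/

noncomputable section

open CategoryTheory Function NumberField IsDedekindDomain Field ValuativeRel
open scoped NumberField ContRepresentation

set_option linter.dupNamespace false
set_option autoImplicit false

namespace Summit.BirchSwinnertonDyer.BirchSwinnertonDyer.Theorems.SchneiderFreeAdditiveX3.PoitouTateReduction

open _root_.ContinuousCohomology
open Literature.NumberTheory.GaloisRepresentations
open Literature.NumberTheory.GaloisRepresentations.DiscreteGaloisModule
open Literature.NumberTheory.GaloisRepresentations.IsNonarchimedeanLocalField
open Literature.NumberTheory.GaloisCohomology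
open Literature.NumberTheory.NumberFields
open Literature.AnabelianGeometry.AbsoluteAnabelian
open Literature.AnabelianGeometry.AbsoluteAnabelian.Prop121vii
open _root_.TopRep _root_.ContRepresentation
open Summit.BirchSwinnertonDyer.Rank1Residual.X11b
open Summit.BirchSwinnertonDyer.Rank1Residual.JET.GlobalDuality

variable {K : Type} [Field K] [NumberField K] {n : ℕ} [NeZero n]

/-- **Milne *ADT* I Thm. 4.10(b) `Ker γ¹ ⊆ Im β¹` for `M = μₙ` at EVERY level `n ≥ 1`**, THE invariant maps
`LocalInvariants.canonical K n`, whenever `n` is odd or `K` has no real place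
(archimedean hypothesis `harch : ∀ w, w.IsReal → Odd n` — the per-place form), UNCONDITIONAL.  In the shape of the hypothesis `hE` of
`exists_localInvariants_duality_of_middleExact_canonical` specialised to `ρ = mu K n`: for a finite set `S`
of places containing the infinite ones, with `n ∉ w` for the finite `w ∉ S`, every family of local classes
`t_v ∈ H¹(K_v, μₙ)` which is orthogonal, under the sum over `S` of the local Tate pairings of THE invariant
maps, to every class of `H¹(K, μₙ^D)` unramified outside `S`, is the localisation on `S` of a global class
`x ∈ H¹(K, μₙ)` unramified outside `S`.  (The general `hE` — all finite `M` — is NOT claimed.)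
[cite: MilneADT2006, Ch. I, Thm. 4.10(b)] [cite: CasselsFrohlichANT1967, Ch. VII §5.1 Main Theorem (B), (D)]
[cite: SerreLocalFields1979, XIV §1 Prop. 3] -/
theorem middleExact_mu_level (harch : ∀ w : InfinitePlace K, w.IsReal → Odd n)
    (S : Finset (Place K)) (_hinf : ∀ w : InfinitePlace K, (Sum.inl w : Place K) ∈ S)
    (hS : ∀ v : HeightOneSpectrum (𝓞 K), (Sum.inr v : Place K) ∉ S →
      ((n : ℕ) : 𝓞 K) ∉ v.asIdeal ∧ GaloisRep.IsUnramifiedAt v (mu K n))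
    (t : Π v : Place K, galoisCohomology ((mu K n).toLocal v) 1)
    (horth : ∀ y : galoisCohomology ((mu K n).tateDual n) 1,
      (∀ v : HeightOneSpectrum (𝓞 K), (Sum.inr v : Place K) ∉ S →
        galoisCohomology.localization ((mu K n).tateDual n) (Sum.inr v) 1 y ∈
          unramifiedSubgroup (GaloisRep.toLocal v ((mu K n).tateDual n)) 1) →
      ∑ v ∈ S, localTatePairingZMod (mu K n) n v (LocalInvariants.canonical K n v) (t v)
        (galoisCohomology.localization ((mu K n).tateDual n) v 1 y) = 0) :
    ∃ x : galoisCohomology (mu K n) 1,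
      (∀ v : HeightOneSpectrum (𝓞 K), (Sum.inr v : Place K) ∉ S →
        galoisCohomology.localization (mu K n) (Sum.inr v) 1 x ∈
          unramifiedSubgroup (GaloisRep.toLocal v (mu K n)) 1) ∧
      ∀ v ∈ S, galoisCohomology.localization (mu K n) v 1 x = t v := by
  classical
  haveI : CompactSpace (absoluteGaloisGroup K) := absoluteGaloisGroup_compactSpace K
  haveI : Finite (MuCarrier K n) := Literature.NumberTheory.GaloisRepresentations.finite_muCarrier K n
  set hR := artinReciprocity_character_holds
  -- the finite places of `S`
  set Sf : Finset (HeightOneSpectrum (𝓞 K)) := S.toRight with hSf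
  have hmemSf : ∀ v, v ∈ Sf ↔ (Sum.inr v : Place K) ∈ S := fun v => by rw [hSf, Finset.mem_toRight]
  -- §1. Kummer half: `t_v = loc_v κ(b)` on the finite part of `S`
  obtain ⟨b, hb0, -, hbt⟩ := exists_forall_localization_δ₀_eq (n := n) Sf fun v => t (Sum.inr v)
  set bu : Kˣ := Units.mk0 b hb0 with hbu
  have hκb : (isSES_kummer K n (NeZero.pos n)).δ₀ (baseUnitsInvariant K (bu : K) bu.ne_zero) =
      (isSES_kummer K n (NeZero.pos n)).δ₀ (baseUnitsInvariant K b hb0) := rfl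
  -- §2. the idèle `ξ = ∏_{v ∈ Sf} ⟨b⟩_v`
  set ξ : ideleGroup K := ∏ v ∈ Sf, localUnits v (globalToLocalUnits v bu) with hξ
  have hξsnd : ∀ v, (ξ : AdeleRing (𝓞 K) K).2 v =
      if v ∈ Sf then algebraMap K (v.adicCompletion K) b else 1 := by
    intro v
    rw [hξ, snd_prod_localUnits]
    split_ifs <;> simp [val_globalToLocalUnits, hbu]
  -- Weil-group lifts of `b` at the finite places
  have hlift : ∀ v : HeightOneSpectrum (𝓞 K), ∃ w : WeilGroup (v.adicCompletion K),
      canonicalArtin (v.adicCompletion K) w = globalToLocalUnits v bu := fun v =>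
    (isLocalArtinMap_canonicalArtin_holds (v.adicCompletion K)).isOpenQuotientMap_artin.surjective _
  choose wv hwv using hlift
  -- §3. class-field half: `ξ` is killed by every faithful character of exponent `n` unramified off `Sf`
  have hsep := exists_eq_principalIdele_mul_mul_pow_of_forall_faithful_character (n := n) Sf ξ
    fun L _ _ _ χ hinj hχn hunr => ?goal
  case goal =>
    -- local units at `v ∉ Sf` are killed by `ψ_{L|K}` (faithfulness of `χ`)
    have hunits : ∀ v : HeightOneSpectrum (𝓞 K), v ∉ Sf → ∀ u : (v.adicCompletion K)ˣ,
        Valued.v (u : v.adicCompletion K) = 1 → artinIdeleMap L hR (localUnits v u) = 1 :=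
      fun v hv u hu => hinj (by rw [map_one]; exact hunr v hv u hu)
    -- the cyclic character of `χ`
    obtain ⟨d, hdne, ζ, ψ, hζ, hker, hval, hdvd⟩ := exists_cyclicCharacter_of_injective L χ hinj
    -- the level `d ∣ n` of `ψ`; write `n = d · m` and transport `[ψ·id_{μ_d}]` to level `n`
    haveI : NeZero d := hdne
    obtain ⟨m, hm⟩ := hdvd n hχn
    have h : d * m = n := hm.symm
    obtain ⟨Ψ, hΨ⟩ := exists_tateDual_muLevel_intertwining (K := K) h
    obtain ⟨ψe, hψe_inj, hψe⟩ := exists_zmod_level_embedding d n (Dvd.intro m h)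
    have hnd : n / d = m := by rw [← h, Nat.mul_div_cancel_left m (NeZero.pos d)]
    -- `χ(ψ_{L|K} ξ) = ∏_{v ∈ Sf} χ(r_L(res_v w_v))⁻¹ = (∏ ζ ^ (ψ(res_v w_v)).val)⁻¹`
    have hχξ : χ (artinIdeleMap L hR ξ) =
        (∏ v ∈ Sf, ζ ^ (ψ (absGaloisRestrict K (v.adicCompletion K)
          (WeilGroup.toAbsGalois (v.adicCompletion K) (wv v)))).val)⁻¹ := by
      rw [← MonoidHom.comp_apply, hξ, map_prod, ← Finset.prod_inv_distrib]
      refine Finset.prod_congr rfl fun v _ => ?_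
      rw [MonoidHom.comp_apply, ← hwv v, artinIdeleMap_localUnits_canonicalArtin_eq_inv L (wv v), map_inv,
        hval]
    -- the class `y = Ψ_* [ψ·id]` is unramified outside `S`
    set y : galoisCohomology ((mu K n).tateDual n) 1 :=
      galoisCohomology.map Ψ 1 (oneCocycleClass _ (scalarCocycle ψ)) with hy
    have hyur : ∀ v : HeightOneSpectrum (𝓞 K), (Sum.inr v : Place K) ∉ S →
        galoisCohomology.localization ((mu K n).tateDual n) (Sum.inr v) 1 y ∈
          unramifiedSubgroup (GaloisRep.toLocal v ((mu K n).tateDual n)) 1 := fun v hv => by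
      rw [hy, show galoisCohomology.localization ((mu K n).tateDual n) (Sum.inr v) 1
          (galoisCohomology.map Ψ 1 (oneCocycleClass _ (scalarCocycle ψ))) =
        galoisCohomology.map (Ψ.restrictField (Place.Completion (Sum.inr v))) 1
          (galoisCohomology.localization ((mu K d).tateDual d) (Sum.inr v) 1 (oneCocycleClass _ (scalarCocycle ψ)))
        from galoisCohomology.res_map_one _ Ψ _]
      exact Levels.map_mem_unramifiedSubgroup _
        (localization_oneCocycleClass_scalarCocycle_mem_unramifiedSubgroup_of_forall_localUnits
          L ψ hker v (hunits v fun h' => hv ((hmemSf v).mp h')))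
    have hsum := horth y hyur
    -- the archimedean terms vanish: the sum is over `Sf`
    have hsub : Sf.map ⟨Sum.inr, Sum.inr_injective⟩ ⊆ S := fun q hq => by
      obtain ⟨v, hv, rfl⟩ := Finset.mem_map.mp hq
      exact (hmemSf v).mp hv
    rw [← Finset.sum_subset hsub (fun q hq hq' => ?_), Finset.sum_map] at hsum
    swap
    · rcases q with w | v
      · rw [localTatePairingZMod_apply]
        rcases w.isReal_or_isComplex with hw | hw
        · exact LocalInvariants.canonical_inl_eq_zero_of_odd (harch w hw) w _
        · exact LocalInvariants.canonical_inl_eq_zero_of_isComplex hw _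
      · exact absurd (Finset.mem_map.mpr ⟨v, (hmemSf v).mpr hq, rfl⟩) hq'
    simp only [Function.Embedding.coeFn_mk] at hsum
    -- each finite term is `m · (-ψ(res_v w_v))` read in `ℤ/n` (level change + Serre XIV §1 Prop. 3 at level `d`)
    have hterm : ∀ v ∈ Sf, localTatePairingZMod (mu K n) n (Sum.inr v)
        (LocalInvariants.canonical K n (Sum.inr v)) (t (Sum.inr v))
        (galoisCohomology.localization ((mu K n).tateDual n) (Sum.inr v) 1 y) =
        ψe (-ψ (absGaloisRestrict K (v.adicCompletion K) (WeilGroup.toAbsGalois (v.adicCompletion K) (wv v)))) := by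
      intro v hv
      rw [← hbt v hv, ← hκb, localTatePairingZMod_apply, ← LocalInvariants.localization_cupProduct,
        LocalInvariants.canonical_inr, hy,
        localInvariantMap_localization_cupProduct_δ₀_map_scalarCocycle h ψ Ψ hΨ _ v,
        localInvariantMap_localization_cupProduct_δ₀_eq_neg_apply L ψ hker bu v (wv v) (hwv v), hψe, hnd]
    rw [Finset.sum_congr rfl fun v hv => hterm v hv, ← map_sum] at hsum
    have hsum' := (injective_iff_map_eq_zero ψe).1 hψe_inj _ hsum
    rw [Finset.sum_neg_distrib, neg_eq_zero] at hsum'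
    -- hence `∑ (ψ(res_v w_v)).val ≡ 0 (mod d)` and `χ(ψ_{L|K} ξ) = (ζ ^ (d · k))⁻¹ = 1`
    have hdvd' : d ∣ ∑ v ∈ Sf, (ψ (absGaloisRestrict K (v.adicCompletion K)
        (WeilGroup.toAbsGalois (v.adicCompletion K) (wv v)))).val := by
      rw [← ZMod.natCast_eq_zero_iff, Nat.cast_sum]
      simpa only [ZMod.natCast_zmod_val] using hsum'
    rw [hχξ, Finset.prod_pow_eq_pow_sum, (hζ.pow_eq_one_iff_dvd _).mpr hdvd', inv_one]
  -- §4. the global class `x = κ(a₀)`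
  obtain ⟨a₀, u, yI, hu, hdec⟩ := hsep
  have hcomp : ∀ v : HeightOneSpectrum (𝓞 K), (ξ : AdeleRing (𝓞 K) K).2 v =
      algebraMap K (v.adicCompletion K) (a₀ : K) * (u : AdeleRing (𝓞 K) K).2 v *
        ((yI : AdeleRing (𝓞 K) K).2 v) ^ n := by
    intro v
    have h := congrArg (fun z : ideleGroup K => ideleGroup.finComp v z) hdec
    simp only [map_mul, map_pow, ideleGroup.finComp_apply, principalIdele_snd] at h
    exact h
  refine ⟨(isSES_kummer K n (NeZero.pos n)).δ₀ (baseUnitsInvariant K (a₀ : K) a₀.ne_zero), fun v hv => ?_,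
    fun q hq => ?_⟩
  · -- unramified outside `S`: `a₀ ∈ 𝒪_vˣ · (K_vˣ)ⁿ` at `v ∉ Sf`
    have hvSf : v ∉ Sf := fun h => hv ((hmemSf v).mp h)
    have h1 := hcomp v
    rw [hξsnd, if_neg hvSf] at h1
    have hu0 : (u : AdeleRing (𝓞 K) K).2 v ≠ 0 := ideleGroup_snd_ne_zero u v
    have hy0 : (yI : AdeleRing (𝓞 K) K).2 v ≠ 0 := ideleGroup_snd_ne_zero yI v
    refine localization_kummer_mem_unramifiedSubgroup_of_eq_unit_mul_pow v (a₀ : K) a₀.ne_zero (hS v hv).1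
      ⟨(Units.mk0 _ hu0)⁻¹, ((yI : AdeleRing (𝓞 K) K).2 v)⁻¹, ?_, ?_⟩
    · rw [Units.val_inv_eq_inv_val, Units.val_mk0, map_inv₀, hu.2.2 v, inv_one]
    · rw [Units.val_inv_eq_inv_val, Units.val_mk0, inv_pow]
      have h2 : algebraMap K (v.adicCompletion K) (a₀ : K) *
          ((u : AdeleRing (𝓞 K) K).2 v * ((yI : AdeleRing (𝓞 K) K).2 v) ^ n) = 1 := by
        rw [← mul_assoc]; exact h1.symm
      rw [eq_inv_of_mul_eq_one_left h2, mul_inv]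
  · rcases q with w | v
    · -- infinite places: everything vanishes (complex place, or odd `n` at a real place)
      have hzero : ∀ c : galoisCohomology ((mu K n).toLocal (Sum.inl w)) 1, c = 0 := fun c => by
        rcases w.isReal_or_isComplex with hw | hw
        swap
        · exact galoisCohomology_inl_eq_zero_of_isComplex (mu K n) hw c
        · refine eq_zero_of_odd_nsmul_galoisCohomology_one_toLocal_inl (mu K n) w (harch w hw) c ?_
          refine galoisCohomology.nsmul_eq_zero_of_forall _ (fun m => ?_) c
          rw [← natCast_zsmul]
          exact zsmul_muCarrier_eq_zero K n m
      rw [hzero (t _)]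
      exact hzero _
    · -- finite places of `S`: `b = a₀ · yⁿ` in `K_v`
      have hvSf : v ∈ Sf := (hmemSf v).mpr hq
      have h1 := hcomp v
      rw [hξsnd, if_pos hvSf, hu.2.1 v hvSf, mul_one] at h1
      rw [← hbt v hvSf]
      exact (localization_kummer_eq_of_eq_mul_pow v (a₀ : K) b a₀.ne_zero hb0 (ideleGroup_snd_ne_zero yI v) h1).symm


/-! ## §2. `M = μₙ^D`, every level `n` -/

section MuDualLevel

variable {K : Type} [Field K] [NumberField K] {n : ℕ} [NeZero n]

/-- `μₙ(K̄)` is killed by `n`. [folklore] -/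
theorem mu_nsmul_eq_zero_level (ζ : MuCarrier K n) : n • ζ = 0 := by
  apply (muCarrierZModEquiv K n).injective
  rw [map_nsmul, map_zero, nsmul_eq_mul, ZMod.natCast_self, zero_mul]


/-- **Milne *ADT* I Thm. 4.10(b) `Ker γ¹ ⊆ Im β¹` for `M = μₙ^{DD}`, every level `n`**, THE invariant maps,
whenever every real place of `K` sees an odd `n` (`∀ w, w.IsReal → Odd n`): `middleExact_mu_level`
transported along biduality `μₙ ⥲ μₙ^{DD}` (`exists_bidual_intertwining`, `middleExact_of_equiv`).
[cite: MilneADT2006, Ch. I, Thm. 4.10(b) and Prop. 0.19] -/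
theorem middleExact_canonical_muBidual_level [Finite (TateDual K (MuCarrier K n) n)]
    [Finite (TateDual K (TateDual K (MuCarrier K n) n) n)]
    (harch : ∀ w : InfinitePlace K, w.IsReal → Odd n)
    (S : Finset (Place K)) (hinf : ∀ w : InfinitePlace K, (Sum.inl w : Place K) ∈ S)
    (hS : ∀ v : HeightOneSpectrum (𝓞 K), (Sum.inr v : Place K) ∉ S →
      ((n : ℕ) : 𝓞 K) ∉ v.asIdeal ∧ GaloisRep.IsUnramifiedAt v (mu K n))
    (t : Π v : Place K, galoisCohomology ((((mu K n).tateDual n).tateDual n).toLocal v) 1)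
    (horth : ∀ y : galoisCohomology ((((mu K n).tateDual n).tateDual n).tateDual n) 1,
      (∀ v : HeightOneSpectrum (𝓞 K), (Sum.inr v : Place K) ∉ S →
        galoisCohomology.localization ((((mu K n).tateDual n).tateDual n).tateDual n) (Sum.inr v) 1 y ∈
          unramifiedSubgroup (GaloisRep.toLocal v ((((mu K n).tateDual n).tateDual n).tateDual n)) 1) →
      ∑ v ∈ S, localTatePairingZMod (((mu K n).tateDual n).tateDual n) n v (LocalInvariants.canonical K n v)
        (t v) (galoisCohomology.localization ((((mu K n).tateDual n).tateDual n).tateDual n) v 1 y) = 0) :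
    ∃ x : galoisCohomology (((mu K n).tateDual n).tateDual n) 1,
      (∀ v : HeightOneSpectrum (𝓞 K), (Sum.inr v : Place K) ∉ S →
        galoisCohomology.localization (((mu K n).tateDual n).tateDual n) (Sum.inr v) 1 x ∈
          unramifiedSubgroup (GaloisRep.toLocal v (((mu K n).tateDual n).tateDual n)) 1) ∧
      ∀ v ∈ S, galoisCohomology.localization (((mu K n).tateDual n).tateDual n) v 1 x = t v := by
  obtain ⟨ι, κ, -, -, hικ⟩ := exists_bidual_intertwining (n := n) (mu K n) (mu_nsmul_eq_zero_level (K := K) (n := n))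
  exact middleExact_of_equiv (LocalInvariants.canonical K n) (mu K n) (((mu K n).tateDual n).tateDual n) ι κ
    hικ (fun t' horth' => middleExact_mu_level harch S hinf hS t' horth') t horth

/-- **Milne *ADT* I Thm. 4.10(b) `Ker γ¹ ⊆ Im β¹` for `M = μₙ^D = Hom(μₙ, μₙ)` (`≅ ℤ/n`), every level `n`,
THE invariant maps, every admissible `S`, whenever every real place of `K` sees an odd `n`
(`∀ w, w.IsReal → Odd n`)**, UNCONDITIONAL: `hE(μₙ^{DD}) = hE((μₙ^D)^D)` (`middleExact_canonical_muBidual_level`) and the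
duality symmetry
`middleExact_canonical_of_middleExact_tateDual`.  (An instance of the hypothesis `hE` of
`exists_localInvariants_duality_of_middleExact_canonical`; the general `hE` — all finite `M` — is NOT claimed.)
[cite: MilneADT2006, Ch. I, Thm. 4.10(b)] [cite: CasselsFrohlichANT1967, Ch. VII §11] -/
theorem middleExact_canonical_muDual_level [Finite (TateDual K (MuCarrier K n) n)]
    (harch : ∀ w : InfinitePlace K, w.IsReal → Odd n)
    (S : Finset (Place K)) (hinf : ∀ w : InfinitePlace K, (Sum.inl w : Place K) ∈ S)
    (hS : ∀ v : HeightOneSpectrum (𝓞 K), (Sum.inr v : Place K) ∉ S →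
      ((n : ℕ) : 𝓞 K) ∉ v.asIdeal ∧ GaloisRep.IsUnramifiedAt v (mu K n))
    (t : Π v : Place K, galoisCohomology (((mu K n).tateDual n).toLocal v) 1)
    (horth : ∀ y : galoisCohomology (((mu K n).tateDual n).tateDual n) 1,
      (∀ v : HeightOneSpectrum (𝓞 K), (Sum.inr v : Place K) ∉ S →
        galoisCohomology.localization (((mu K n).tateDual n).tateDual n) (Sum.inr v) 1 y ∈
          unramifiedSubgroup (GaloisRep.toLocal v (((mu K n).tateDual n).tateDual n)) 1) →
      ∑ v ∈ S, localTatePairingZMod ((mu K n).tateDual n) n v (LocalInvariants.canonical K n v) (t v)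
        (galoisCohomology.localization (((mu K n).tateDual n).tateDual n) v 1 y) = 0) :
    ∃ x : galoisCohomology ((mu K n).tateDual n) 1,
      (∀ v : HeightOneSpectrum (𝓞 K), (Sum.inr v : Place K) ∉ S →
        galoisCohomology.localization ((mu K n).tateDual n) (Sum.inr v) 1 x ∈
          unramifiedSubgroup (GaloisRep.toLocal v ((mu K n).tateDual n)) 1) ∧
      ∀ v ∈ S, galoisCohomology.localization ((mu K n).tateDual n) v 1 x = t v := by
  haveI := DiscreteGaloisModule.TateDual.finite K (TateDual K (MuCarrier K n) n) n
  exact middleExact_canonical_of_middleExact_tateDual ((mu K n).tateDual n)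
    (fun f => DiscreteGaloisModule.TateDual.nsmul_eq_zero f)
    (fun u hu => middleExact_canonical_muBidual_level harch S hinf hS u hu) t horth

end MuDualLevel

/-! ## §3. `M = ℤ/n` (constant coefficients), every level `n` -/

section TrivialLevel

variable {K : Type} [Field K] [NumberField K] {n : ℕ} [NeZero n]

/-- **`ℤ/n ⥲ Hom(μₙ, μₙ) = μₙ^D`, `m ↦ m·id`, is a bijective intertwining map** from ANY discrete Galois
module structure on `ℤ/n` with trivial action (`(σ(m·id))(ζ) = σ(m·σ⁻¹ζ) = m·ζ`; injective on a generator
of the cyclic group `μₙ(K̄) ≅ ℤ/n`, bijective as `#Hom(μₙ, μₙ) = #μₙ = n`).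
[cite: MilneADT2006, Ch. I §0 (examples of M^D)] -/
theorem exists_trivial_intertwining_muDual_bijective_level (ρ : DiscreteGaloisModule K (ZMod n))
    (htriv : ∀ (σ : absoluteGaloisGroup K) (m : ZMod n), ρ σ m = m) :
    ∃ φ : ρ.toContRepresentation →ⁱL ((mu K n).tateDual n).toContRepresentation,
      (∀ (m : ZMod n) (ζ : MuCarrier K n), φ m ζ = m.val • ζ) ∧ Bijective φ := by
  -- the map on carriers
  let Φ : ZMod n →+ TateDual K (MuCarrier K n) n :=
    { toFun := fun m => ((m.val • AddMonoidHom.id (MuCarrier K n) : MuCarrier K n →+ MuCarrier K n))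
      map_zero' := DiscreteGaloisModule.TateDual.ext fun ζ => by
        change (ZMod.val 0) • ζ = 0
        rw [ZMod.val_zero, zero_nsmul]
      map_add' := fun m m' => DiscreteGaloisModule.TateDual.ext fun ζ => by
        change (m + m').val • ζ = m.val • ζ + m'.val • ζ
        rw [← add_nsmul, ZMod.val_add]
        conv_rhs => rw [← Nat.mod_add_div (m.val + m'.val) n, add_nsmul, mul_nsmul ζ n,
          mu_nsmul_eq_zero_level, nsmul_zero, add_zero] }
  have hΦ : ∀ (m : ZMod n) (ζ : MuCarrier K n), Φ m ζ = m.val • ζ := fun m ζ => rfl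
  -- injectivity (on a generator of `μₙ(K̄) ≅ ℤ/n`)
  have hinj : Injective Φ := by
    refine (injective_iff_map_eq_zero Φ).2 fun m hm => ?_
    let e : MuCarrier K n ≃+ ZMod n := muCarrierZModEquiv K n
    have h1 : m.val • e.symm 1 = 0 := by
      have h := hΦ m (e.symm 1)
      rw [hm, DiscreteGaloisModule.TateDual.zero_apply] at h
      exact h.symm
    have h2 : (m.val : ZMod n) = 0 := by
      have h3 := congrArg e h1
      rw [map_nsmul, AddEquiv.apply_symm_apply, map_zero, nsmul_eq_mul, mul_one] at h3
      exact h3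
    rw [ZMod.natCast_zmod_val] at h2
    exact h2
  -- bijectivity by counting
  have hcard : Nat.card (TateDual K (MuCarrier K n) n) = Nat.card (ZMod n) := by
    have hc : Nat.card (TateDual K (MuCarrier K n) n) = Nat.card (MuCarrier K n) :=
      HomCarrier.natCard_eq (muEquivZMod K n) (mu_nsmul_eq_zero_level (K := K) (n := n))
    rw [hc, Nat.card_congr (muCarrierZModEquiv K n).toEquiv]
  haveI : Finite (TateDual K (MuCarrier K n) n) := DiscreteGaloisModule.TateDual.finite K (MuCarrier K n) n
  have hbij : Bijective Φ := hinj.bijective_of_nat_card_le (le_of_eq hcard)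
  refine ⟨{ toContinuousLinearMap := ⟨Φ.toIntLinearMap, continuous_of_discreteTopology⟩
            isIntertwining' := fun σ => ContinuousLinearMap.ext fun m =>
              DiscreteGaloisModule.TateDual.ext fun ζ => ?_ }, fun m ζ => rfl, hbij⟩
  change Φ (ρ σ m) ζ = (mu K n).tateDual n σ (Φ m) ζ
  rw [htriv, DiscreteGaloisModule.tateDual_apply_apply_apply, hΦ, hΦ, map_nsmul,
    ← Module.End.mul_apply, ← map_mul, mul_inv_cancel, map_one, Module.End.one_apply]

/-- **Milne *ADT* I Thm. 4.10(b) `Ker γ¹ ⊆ Im β¹` for the CONSTANT module `M = ℤ/n`, every level `n`**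
(any discrete Galois module structure `ρ` on `ZMod n` with trivial action, e.g.
`ContinuousRep.trivial Γ_K ℤ (ZMod n)`), THE invariant maps, every finite `S ⊇ {v ∣ ∞} ∪ {v ∣ n}`, over any
number field all of whose real places see an odd `n` (`∀ w, w.IsReal → Odd n`), UNCONDITIONAL: transport of
`middleExact_canonical_muDual_level` along `ℤ/n ⥲ Hom(μₙ, μₙ)`.  Classically (Grunwald–Wang with ramification
control, in Poitou–Tate form): local characters `χ_v : Γ_{K_v} → ℤ/n` (`v ∈ S`) with
`∑_{v∈S} inv_v(χ_v ∪ y_v) = 0` for every `y ∈ H¹(K, (ℤ/n)^D)` unramified outside `S` are the restrictions of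
ONE global character `Γ_K → ℤ/n` unramified outside `S`.  (An instance of the hypothesis `hE` of
`exists_localInvariants_duality_of_middleExact_canonical`; the general `hE` — all finite `M` — is NOT claimed.)
[cite: MilneADT2006, Ch. I, Thm. 4.10(b)] [cite: NeukirchSchmidtWingberg2008, VIII §6] -/
theorem middleExact_canonical_trivial_level [Finite (ZMod n)] (harch : ∀ w : InfinitePlace K, w.IsReal → Odd n)
    (ρ : DiscreteGaloisModule K (ZMod n)) (htriv : ∀ (σ : absoluteGaloisGroup K) (m : ZMod n), ρ σ m = m)
    (S : Finset (Place K)) (hinf : ∀ w : InfinitePlace K, (Sum.inl w : Place K) ∈ S)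
    (hS : ∀ v : HeightOneSpectrum (𝓞 K), (Sum.inr v : Place K) ∉ S → ((n : ℕ) : 𝓞 K) ∉ v.asIdeal)
    (t : Π v : Place K, galoisCohomology (ρ.toLocal v) 1)
    (horth : ∀ y : galoisCohomology (ρ.tateDual n) 1,
      (∀ v : HeightOneSpectrum (𝓞 K), (Sum.inr v : Place K) ∉ S →
        galoisCohomology.localization (ρ.tateDual n) (Sum.inr v) 1 y ∈
          unramifiedSubgroup (GaloisRep.toLocal v (ρ.tateDual n)) 1) →
      ∑ v ∈ S, localTatePairingZMod ρ n v (LocalInvariants.canonical K n v) (t v)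
        (galoisCohomology.localization (ρ.tateDual n) v 1 y) = 0) :
    ∃ x : galoisCohomology ρ 1,
      (∀ v : HeightOneSpectrum (𝓞 K), (Sum.inr v : Place K) ∉ S →
        galoisCohomology.localization ρ (Sum.inr v) 1 x ∈ unramifiedSubgroup (GaloisRep.toLocal v ρ) 1) ∧
      ∀ v ∈ S, galoisCohomology.localization ρ v 1 x = t v := by
  haveI := DiscreteGaloisModule.TateDual.finite K (MuCarrier K n) n
  obtain ⟨φ, -, hφbij⟩ := exists_trivial_intertwining_muDual_bijective_level ρ htriv
  obtain ⟨ψ, hψφ, -⟩ := exists_inverse_intertwining_of_bijective φ hφbij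
  -- `μₙ` is unramified at `v ∤ n`
  have hS' : ∀ v : HeightOneSpectrum (𝓞 K), (Sum.inr v : Place K) ∉ S →
      ((n : ℕ) : 𝓞 K) ∉ v.asIdeal ∧ GaloisRep.IsUnramifiedAt v (mu K n) := fun v hv =>
    ⟨hS v hv, isUnramifiedAt_mu v (hS v hv)⟩
  exact middleExact_of_equiv (LocalInvariants.canonical K n) ((mu K n).tateDual n) ρ ψ φ hψφ
    (fun t' horth' => middleExact_canonical_muDual_level harch S hinf hS' t' horth') t horth

end TrivialLevel


end Summit.BirchSwinnertonDyer.BirchSwinnertonDyer.Theorems.SchneiderFreeAdditiveX3.PoitouTateReduction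

end
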